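import Mathlib

/-!
# Selection obstruction for receding radii — why re-ending absorption must be BAND-UNIFORM
# (crux `CensorshipAlongKerrEnds`, stmt-FinalStateConjecture-18521, route ExactKerrEnds;
#  strategist gen 1, 2026-08-17; kernel-checked appendix to `STRATEGY-CENSUS.md` §Strengthen/§Decomposition)

Every architecture for `C₁` that Kerr-ends a one-parameter family `c ↦ G c` of good data by a
receding far modification at radius `R` and then walks to the base datum along a continuous path
`t ↦ (c t, R t)` with `c t → 0` needs, for each visited `c`, the radius `R t` to lie above the
threshold `R₂ (c t)` beyond which the re-ended member is censored.  The lead's physics stub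
(`stub_reEndingAbsorptionC`, line `Sketch` v4) asks for this threshold to be LOCALLY BOUNDED on
compact bands of parameters avoiding `0` (`EventuallyOnBands`).  One might hope to weaken the stub to
a POINTWISE statement ("for every `c ≠ 0` there is `R₂ c` beyond which `H c R` is censored") — a
statement about ONE settled development at a time, with no uniformity in `c`.

This file shows, abstractly, that the pointwise form is useless for any continuous selection: there
is a threshold function `R₂ : ℝ → ℝ` (finite everywhere, hence "pointwise eventually good" on every
fibre) such that NO continuous path `t ↦ (c t, R t)` on `[0, ∞)` starting off the axis (`c 0 ≠ 0`)
and approaching it (`c t → 0`) stays in the good region `{R₂ (c t) ≤ R t}` — it always dips below the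
threshold somewhere (`exists_lt_threshold_of_continuous_path`).  The threshold used is unbounded on
every open interval (it reads off the code of a rational number), which is exactly what local
boundedness on bands excludes.  Consequently the band-uniform clause of the absorption stub is not
an artefact of the proof format: any proof of `C₁` through a receding re-ending of a family must
control censoredness LOCALLY UNIFORMLY in the family parameter, i.e. it must contain the stability of
censoredness of settled data under small compactly supported perturbations (Cauchy stability up to a
late leaf + asymptotic stability of the settled end state) even before the far modification is
considered.  Informal physics is untouched; this is a statement about the quantifier structure.

References: Lines/Sketch.lean v4 §2 (`ReEndingAbsorptionC`, `RecedingSelection`);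
Theorems/ExactKerrEndsCensorshipAlongKerrEndsDefs.lean (`EventuallyOnBands`);
Theorems/ExactKerrEndsCensorshipAlongKerrEndsRecedingSelection.lean (p153977, the selection that
CONSUMES band-uniformity).
-/

set_option linter.dupNamespace false

noncomputable section

open Set Filter Topology

namespace Summit.FinalStateConjecture.FinalStateConjecture.Cruxes.CensorshipAlongKerrEnds.Strategist

open scoped Classical in
/-- A threshold function which is finite at every point but unbounded above on every nonempty open
interval: at a rational point it returns the code of that rational, elsewhere `0`. [folklore] -/
def wildThreshold (x : ℝ) : ℝ :=
  if h : ∃ q : ℚ, (q : ℝ) = x then (Encodable.encode h.choose : ℝ) else 0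

/-- At a rational point the wild threshold is the code of that rational. [folklore] -/
theorem wildThreshold_ratCast (q : ℚ) : wildThreshold (q : ℝ) = (Encodable.encode q : ℝ) := by
  classical
  have h : ∃ q' : ℚ, (q' : ℝ) = (q : ℝ) := ⟨q, rfl⟩
  have hch : h.choose = q := Rat.cast_injective h.choose_spec
  rw [wildThreshold, dif_pos h, hch]

/-- In every nonempty open real interval there is a rational whose code exceeds any given bound
(the interval contains infinitely many rationals, only finitely many rationals have small code).
[folklore] -/
theorem exists_rat_mem_Ioo_code_gt {a b : ℝ} (hab : a < b) (B : ℝ) :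
    ∃ q : ℚ, a < (q : ℝ) ∧ (q : ℝ) < b ∧ B < (Encodable.encode q : ℝ) := by
  -- rationals strictly between `a` and `b`
  obtain ⟨qa, haq, hqb⟩ := exists_rat_btwn hab
  obtain ⟨qb, haqb, hqbb⟩ := exists_rat_btwn hqb
  have hlt : qa < qb := by exact_mod_cast haqb
  -- the set of rationals in `(qa, qb)` is infinite
  have hinf : (Set.Ioo qa qb).Infinite := Set.Ioo_infinite hlt
  -- rationals with code `≤ ⌈B⌉₊` form a finite set (the coding is injective)
  have hfin : (Encodable.encode ⁻¹' Set.Iic ⌈B⌉₊ : Set ℚ).Finite :=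
    (Set.finite_Iic _).preimage (Encodable.encode_injective.injOn)
  -- so some rational in the interval has large code
  obtain ⟨q, hqmem, hqnot⟩ := (hinf.sdiff hfin).nonempty
  refine ⟨q, ?_, ?_, ?_⟩
  · exact haq.trans (by exact_mod_cast hqmem.1)
  · exact lt_trans (by exact_mod_cast hqmem.2) hqbb
  · have hlt' : ⌈B⌉₊ < Encodable.encode q := by
      simpa [Set.mem_preimage, Set.mem_Iic, not_le] using hqnot
    calc B ≤ (⌈B⌉₊ : ℝ) := Nat.le_ceil B
      _ < (Encodable.encode q : ℝ) := by exact_mod_cast hlt'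

/-- **Selection obstruction.** For the wild threshold, every continuous path `t ↦ (c t, R t)` on
`[0, ∞)` which starts off the axis (`c 0 ≠ 0`) and approaches it (`c t → 0` as `t → ∞`) dips
strictly below the threshold at some time: pointwise finiteness of a censoring radius `R₂ c` on each
fibre does not allow a continuous receding selection `R t ≥ R₂ (c t)`.  (Band-uniformity — local
boundedness of `R₂` on compact sets avoiding `0` — is what the selection lemma of the line consumes.)
[folklore] -/
theorem exists_lt_threshold_of_continuous_path (c R : ℝ → ℝ) (hc : Continuous c) (hR : Continuous R)
    (h0 : c 0 ≠ 0) (hlim : Tendsto c atTop (𝓝 0)) :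
    ∃ t : ℝ, 0 ≤ t ∧ R t < wildThreshold (c t) := by
  -- a late time `T ≥ 0` at which `|c T| < |c 0|`
  have hpos : 0 < |c 0| := abs_pos.mpr h0
  have hev : ∀ᶠ t in atTop, |c t| < |c 0| := by
    have := (Metric.tendsto_nhds.mp hlim) (|c 0|) hpos
    filter_upwards [this] with t ht
    simpa [Real.dist_eq] using ht
  obtain ⟨T₀, hT₀⟩ := hev.exists_forall_of_atTop
  set T : ℝ := max T₀ 0 with hTdef
  have hT0 : 0 ≤ T := le_max_right _ _
  have hcT : |c T| < |c 0| := hT₀ T (le_max_left _ _)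
  have hne : c T ≠ c 0 := fun h ↦ (lt_irrefl _) (h ▸ hcT)
  -- `R` is bounded above on `[0, T]`
  obtain ⟨B, hB⟩ : ∃ B : ℝ, ∀ t ∈ Icc (0 : ℝ) T, R t ≤ B := by
    have hcpt : IsCompact (R '' Icc (0 : ℝ) T) := (isCompact_Icc).image hR
    obtain ⟨B, hB⟩ := hcpt.bddAbove
    exact ⟨B, fun t ht ↦ hB ⟨t, ht, rfl⟩⟩
  -- the image of `[0, T]` under `c` contains the open interval between `c 0` and `c T`
  have hsub : uIcc (c 0) (c T) ⊆ c '' Icc (0 : ℝ) T := by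
    have := intermediate_value_uIcc (a := (0 : ℝ)) (b := T) hc.continuousOn
    rwa [uIcc_of_le hT0] at this
  -- a rational with large code strictly between `c 0` and `c T`
  have hlt : c 0 ⊓ c T < c 0 ⊔ c T := inf_lt_sup.mpr hne.symm
  obtain ⟨q, hq1, hq2, hqB⟩ := exists_rat_mem_Ioo_code_gt hlt B
  have hqmem : (q : ℝ) ∈ uIcc (c 0) (c T) :=
    show (q : ℝ) ∈ Icc (c 0 ⊓ c T) (c 0 ⊔ c T) from ⟨hq1.le, hq2.le⟩
  obtain ⟨t, ht, hct⟩ := hsub hqmem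
  refine ⟨t, ht.1, ?_⟩
  calc R t ≤ B := hB t ht
    _ < (Encodable.encode q : ℝ) := hqB
    _ = wildThreshold (c t) := by rw [hct, wildThreshold_ratCast]

/-- **Corollary (the shape used in the census).** There is a threshold `R₂ : ℝ → ℝ` (finite at every
point) such that no continuous path `(c, R)` on `[0, ∞)` with `c 0 ≠ 0`, `c t → 0` satisfies
`R₂ (c t) ≤ R t` for all `t ≥ 0`. [folklore] -/
theorem exists_threshold_without_continuous_selection :
    ∃ R₂ : ℝ → ℝ, ∀ c R : ℝ → ℝ, Continuous c → Continuous R → c 0 ≠ 0 →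
      Tendsto c atTop (𝓝 0) → ¬ ∀ t : ℝ, 0 ≤ t → R₂ (c t) ≤ R t := by
  refine ⟨wildThreshold, fun c R hc hR h0 hlim hall ↦ ?_⟩
  obtain ⟨t, ht, hlt⟩ := exists_lt_threshold_of_continuous_path c R hc hR h0 hlim
  exact (not_le.mpr hlt) (hall t ht)

end Summit.FinalStateConjecture.FinalStateConjecture.Cruxes.CensorshipAlongKerrEnds.Strategist

end
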